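import Summits.Ventures.PercRepro2.CaseOneRootsAndOI
import Summits.Ventures.PercRepro2.CaseOneRootsOnlyQ

/-!
# The Q-threshold forms `(ii-Q)`, `(i-Q)` for the roots-and-`o` class (blind cell PercRepro2,
p1 g19; the `(i-Q)` face theorem of P1-FACE §5 for uwo, and the `(ii-Q)` twin)

The D-world inductions of `CaseOneRootsAndMark` / `CaseOneRootsAndOI` work at EVERY threshold pair
`(c₀, c₁)` with `c₀, c₁ ≥ 0`: pinning an `a₁a₃`-edge adds nonnegative terms (`iiExprD_a1_edge` +
`covDw_nonneg`, resp. `iExprD_a1_edge_of_rootsAndO` + `covDwI_nonpos`), pinning an `a₂a₃`-edge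
scales by `(1 − p₂)²`, and for `a₃` a leaf at `o` in the support the `o ∈ C₂`-masses vanish on
`{a₃ ∈ C₁}` (`prob_AO_eq_zero_of_leaf_supp_o`), leaving `c₀` times a BHK bracket of the right sign
(`bhk_cross_cluster_avoid` for `(ii)`: `{b ∈ C₂}` against `{a₃ ∈ C₁}`;
`TypeRB.bhk_other_cluster_avoid` for `(i)`: `{b ∈ C₁}` with `{a₃ ∈ C₁}`, both under
`a₂ ↮ {a₁, a₃}`). Hence **`iiExprD_nonneg_of_rootsAndO`**, **`iExprD_nonneg_of_rootsAndO`** at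
every nonnegative pair, and at the Q pair `(P(Q, o ∈ U), P(Q))` with `odds_q`:
**`zSplitIIQ_of_rootsAndO`**, **`zSplitIQ_of_rootsAndO`** — `(ii-Q)` and `(i-Q)` for `a₃` adjacent
to the roots (any multiplicities) and to `o`, every finite graph, every weight vector. Own code;
standard axioms.
-/

namespace Summit.Ventures.PercRepro2

namespace CaseOne

section Base
variable {V : Type*} {E : Type*} [Fintype E] [DecidableEq E] [Fintype V] [DecidableEq V]
  {R : Type*} [Field R] [LinearOrder R] [IsStrictOrderedRing R]
variable {ends : E → Sym2 V} {a₁ a₂ a₃ : V}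

/-- **The D-world `(i)` of a leaf at `o` in the support** is `≥ 0` at every pair with `c₀ ≥ 0`. -/
theorem iExprD_nonneg_of_leaf_supp_o {p : E → R} (hp : IsProbVec p) {o : V} {e₀ : E}
    (hl : IsLeafSupp p ends o a₃ e₀) (h1 : a₁ ≠ a₃) (b : V) (c₀ c₁ : R) (hc₀ : 0 ≤ c₀) :
    0 ≤ iExprD p ends o a₁ a₂ a₃ b c₀ c₁ := by
  rw [iExprD_eq]
  rw [prob_AO_eq_zero_of_leaf_supp_o hl h1 (X := connEvent ends a₁ b ∩ connEvent ends a₁ a₃ ∩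
      connEvent ends a₂ o ∩ (connEvent ends a₁ a₂)ᶜ) (fun _ h => ⟨⟨h.1.1.2, h.1.2⟩, h.2⟩),
    prob_AO_eq_zero_of_leaf_supp_o hl h1 (X := connEvent ends a₁ a₃ ∩ connEvent ends a₂ o ∩
      (connEvent ends a₁ a₂)ᶜ) (fun _ h => h)]
  have hbhk := TypeRB.bhk_other_cluster_avoid p ends hp a₂ a₁ (X := ({a₁, a₃} : Finset V)) (by simp)
    (isUpperSet_mem_setOf b) (isUpperSet_mem_setOf a₃)
  rw [← connEvent_eq_clusterInEvent ends a₁ b, ← connEvent_eq_clusterInEvent ends a₁ a₃,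
    ← Dw_eq_avoidAll, B₁A_inter_Dw, A_inter_Dw] at hbhk
  have key : 0 ≤ prob p (Dw ends a₁ a₂ a₃) *
      prob p (connEvent ends a₁ b ∩ connEvent ends a₁ a₃ ∩ (connEvent ends a₁ a₂)ᶜ) -
      prob p (connEvent ends a₁ b ∩ Dw ends a₁ a₂ a₃) *
        prob p (connEvent ends a₁ a₃ ∩ (connEvent ends a₁ a₂)ᶜ) := by linarith [hbhk]
  have := mul_nonneg hc₀ key
  linarith [this]

/-- **The D-world `(ii)` of a leaf at `o` in the support** is nonnegative at every pair with
`c₀ ≥ 0` (`{b ∈ C₂}` against `{a₃ ∈ C₁}` under `a₂ ↮ {a₁, a₃}`: `bhk_cross_cluster_avoid`). -/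
theorem iiExprD_nonneg_of_leaf_supp_o {p : E → R} (hp : IsProbVec p) {o : V} {e₀ : E}
    (hl : IsLeafSupp p ends o a₃ e₀) (h1 : a₁ ≠ a₃) (b : V) (c₀ c₁ : R) (hc₀ : 0 ≤ c₀) :
    0 ≤ iiExprD p ends o a₁ a₂ a₃ b c₀ c₁ := by
  rw [iiExprD_eq]
  rw [prob_AO_eq_zero_of_leaf_supp_o hl h1 (X := connEvent ends a₂ b ∩ connEvent ends a₁ a₃ ∩
      connEvent ends a₂ o ∩ (connEvent ends a₁ a₂)ᶜ) (fun _ h => ⟨⟨h.1.1.2, h.1.2⟩, h.2⟩),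
    prob_AO_eq_zero_of_leaf_supp_o hl h1 (X := connEvent ends a₁ a₃ ∩ connEvent ends a₂ o ∩
      (connEvent ends a₁ a₂)ᶜ) (fun _ h => h)]
  have hbhk := bhk_cross_cluster_avoid p hp ends a₂ a₁ (X := ({a₁, a₃} : Finset V)) (by simp)
    (isUpperSet_mem_setOf b) (isUpperSet_mem_setOf a₃)
  rw [← connEvent_eq_clusterInEvent ends a₂ b, ← connEvent_eq_clusterInEvent ends a₁ a₃,
    ← Dw_eq_avoidAll, BA_inter_Dw, A_inter_Dw] at hbhk
  have key : prob p (Dw ends a₁ a₂ a₃) *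
      prob p (connEvent ends a₂ b ∩ connEvent ends a₁ a₃ ∩ (connEvent ends a₁ a₂)ᶜ) -
      prob p (connEvent ends a₂ b ∩ Dw ends a₁ a₂ a₃) *
        prob p (connEvent ends a₁ a₃ ∩ (connEvent ends a₁ a₂)ᶜ) ≤ 0 := by linarith [hbhk]
  have := mul_nonpos_of_nonneg_of_nonpos hc₀ key
  linarith [this]

end Base

section Induction
variable {V : Type*} {E : Type*} [Fintype E] [DecidableEq E] [Fintype V] [DecidableEq V]
  {R : Type*} [Field R] [LinearOrder R] [IsStrictOrderedRing R]
variable {ends : E → Sym2 V} {a₁ a₂ a₃ : V} {e₀ : E}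

/-- **The D-world `(i)` of the roots-and-`o` class at every nonnegative threshold pair.** -/
theorem iExprD_nonneg_of_rootsAndO (p : E → R) (hp : IsProbVec p) {o : V}
    (he₀ : ends e₀ = s(o, a₃))
    (hroot : ∀ e, a₃ ∈ ends e → e ≠ e₀ → ends e = s(a₁, a₃) ∨ ends e = s(a₂, a₃)) (ho : o ≠ a₃)
    (h1 : a₁ ≠ a₃) {b : V} (hb : b ≠ a₃) (c₀ c₁ : R) (hc₀ : 0 ≤ c₀) (hc₁ : 0 ≤ c₁) :
    0 ≤ iExprD p ends o a₁ a₂ a₃ b c₀ c₁ := by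
  have hro : ∀ e, a₃ ∈ ends e → ends e = s(a₁, a₃) ∨ ends e = s(a₂, a₃) ∨ ends e = s(o, a₃) := by
    intro e he
    by_cases hee : e = e₀
    · right; right; rw [hee, he₀]
    · rcases hroot e he hee with h | h
      · exact Or.inl h
      · exact Or.inr (Or.inl h)
  generalize hn : (liveRoot p ends a₃ e₀).card = n
  induction n using Nat.strong_induction_on generalizing p with
  | _ n ih =>
    by_cases h0 : liveRoot p ends a₃ e₀ = ∅
    · have hnull : ∀ e, a₃ ∈ ends e → e ≠ e₀ → p e = 0 := by
        intro e he hne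
        by_contra hc
        have : e ∈ liveRoot p ends a₃ e₀ := by simp [liveRoot, he, hne, hc]
        rw [h0] at this
        exact absurd this (Finset.notMem_empty e)
      exact iExprD_nonneg_of_leaf_supp_o hp ⟨he₀, hnull, ho⟩ h1 b c₀ c₁ hc₀
    · obtain ⟨e, he⟩ := Finset.nonempty_iff_ne_empty.mpr h0
      have he' : a₃ ∈ ends e ∧ e ≠ e₀ := by
        have := he
        simp only [liveRoot, Finset.mem_filter, Finset.mem_univ, true_and] at this
        exact ⟨this.1, this.2.1⟩
      have hlt : ((liveRoot p ends a₃ e₀).erase e).card < n := by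
        rw [← hn]; exact Finset.card_erase_lt_of_mem he
      have hp0 : IsProbVec (Function.update p e 0) := hp.update e le_rfl zero_le_one
      have hrec := ih _ hlt (Function.update p e 0) hp0 (by rw [liveRoot_update])
      have hpe : 0 ≤ p e := hp.nonneg e
      have hpe' : 0 ≤ 1 - p e := sub_nonneg.2 (hp.le_one e)
      rcases hroot e he'.1 he'.2 with h | h
      · rw [iExprD_a1_edge_of_rootsAndO p hro h hb c₀ c₁]
        have hcov := covDwI_nonpos (Function.update p e 0) hp0 ends o a₁ a₂ a₃ b
        have hY : prob (Function.update p e 0) (connEvent ends a₁ b ∩ Dw ends a₁ a₂ a₃) ≤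
            prob (Function.update p e 0) ((connEvent ends a₁ b ∪ connEvent ends a₃ b) ∩
              Dw ends a₁ a₂ a₃) :=
          prob_mono hp0 (Set.inter_subset_inter_left _ Set.subset_union_left)
        have hdA : prob (Function.update p e 0) (connEvent ends a₁ a₃ ∩ Dw ends a₁ a₂ a₃) ≤
            prob (Function.update p e 0) (Dw ends a₁ a₂ a₃) :=
          prob_mono hp0 Set.inter_subset_right
        have hO : 0 ≤ prob (Function.update p e 0) (connEvent ends a₂ o ∩ Dw ends a₁ a₂ a₃) :=
          prob_nonneg hp0 _
        have hAO : 0 ≤ prob (Function.update p e 0) (connEvent ends a₂ o ∩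
            connEvent ends a₁ a₃ ∩ Dw ends a₁ a₂ a₃) := prob_nonneg hp0 _
        have t1 := mul_nonpos_of_nonneg_of_nonpos (mul_nonneg hpe hc₁) hcov
        have t2 := mul_nonneg hpe' hrec
        have t3 := mul_nonneg (mul_nonneg hpe (sub_nonneg.2 hY))
          (add_nonneg (mul_nonneg hc₁ (add_nonneg (mul_nonneg hpe hO) (mul_nonneg hpe' hAO)))
            (mul_nonneg (mul_nonneg hc₀ hpe') (sub_nonneg.2 hdA)))
        linarith [t1, t2, t3]
      · rw [iExprD_a2_edge p h o b c₀ c₁]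
        exact mul_nonneg (pow_nonneg hpe' 2) hrec

/-- **The D-world `(ii)` of the roots-and-`o` class at every nonnegative threshold pair.** -/
theorem iiExprD_nonneg_of_rootsAndO (p : E → R) (hp : IsProbVec p) {o : V}
    (he₀ : ends e₀ = s(o, a₃))
    (hroot : ∀ e, a₃ ∈ ends e → e ≠ e₀ → ends e = s(a₁, a₃) ∨ ends e = s(a₂, a₃)) (ho : o ≠ a₃)
    (h1 : a₁ ≠ a₃) (b : V) (c₀ c₁ : R) (hc₀ : 0 ≤ c₀) (hc₁ : 0 ≤ c₁) :
    0 ≤ iiExprD p ends o a₁ a₂ a₃ b c₀ c₁ := by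
  generalize hn : (liveRoot p ends a₃ e₀).card = n
  induction n using Nat.strong_induction_on generalizing p with
  | _ n ih =>
    by_cases h0 : liveRoot p ends a₃ e₀ = ∅
    · have hnull : ∀ e, a₃ ∈ ends e → e ≠ e₀ → p e = 0 := by
        intro e he hne
        by_contra hc
        have : e ∈ liveRoot p ends a₃ e₀ := by simp [liveRoot, he, hne, hc]
        rw [h0] at this
        exact absurd this (Finset.notMem_empty e)
      exact iiExprD_nonneg_of_leaf_supp_o hp ⟨he₀, hnull, ho⟩ h1 b c₀ c₁ hc₀
    · obtain ⟨e, he⟩ := Finset.nonempty_iff_ne_empty.mpr h0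
      have he' : a₃ ∈ ends e ∧ e ≠ e₀ := by
        have := he
        simp only [liveRoot, Finset.mem_filter, Finset.mem_univ, true_and] at this
        exact ⟨this.1, this.2.1⟩
      have hlt : ((liveRoot p ends a₃ e₀).erase e).card < n := by
        rw [← hn]; exact Finset.card_erase_lt_of_mem he
      have hp0 : IsProbVec (Function.update p e 0) := hp.update e le_rfl zero_le_one
      have hrec := ih _ hlt (Function.update p e 0) hp0 (by rw [liveRoot_update])
      have hpe : 0 ≤ p e := hp.nonneg e
      have hpe' : 0 ≤ 1 - p e := sub_nonneg.2 (hp.le_one e)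
      rcases hroot e he'.1 he'.2 with h | h
      · rw [iiExprD_a1_edge p h o b c₀ c₁]
        have hcov := covDw_nonneg (Function.update p e 0) hp0 ends o a₁ a₂ a₃ b
        have t1 := mul_nonneg (mul_nonneg hpe hc₁) hcov
        have t2 := mul_nonneg hpe' hrec
        linarith [t1, t2]
      · rw [iiExprD_a2_edge p h o b c₀ c₁]
        exact mul_nonneg (pow_nonneg hpe' 2) hrec

/-- **`(i-Q)` for `a₃` adjacent to the roots (any multiplicities) and to `o`** through `e₀` — the
`(i-Q)` face theorem of uwo (P1-FACE §5). -/
theorem zSplitIQ_of_rootsAndO (p : E → R) (hp : IsProbVec p) {o : V} (he₀ : ends e₀ = s(o, a₃))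
    (hroot : ∀ e, a₃ ∈ ends e → e ≠ e₀ → ends e = s(a₁, a₃) ∨ ends e = s(a₂, a₃)) (ho : o ≠ a₃)
    (h1 : a₁ ≠ a₃) {b : V} (hb : b ≠ a₃) : ZSplitIQ p ends o a₁ a₂ a₃ b := by
  unfold ZSplitIQ
  exact iExprT_nonneg_of_dworld p hp ends o a₁ a₂ a₃ b _ _
    (iExprD_nonneg_of_rootsAndO p hp he₀ hroot ho h1 hb _ _ (prob_nonneg hp _) (prob_nonneg hp _))
    (odds_q p hp ends o a₁ a₂ a₃)

/-- **`(ii-Q)` for `a₃` adjacent to the roots (any multiplicities) and to `o`** through `e₀`. -/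
theorem zSplitIIQ_of_rootsAndO (p : E → R) (hp : IsProbVec p) {o : V} (he₀ : ends e₀ = s(o, a₃))
    (hroot : ∀ e, a₃ ∈ ends e → e ≠ e₀ → ends e = s(a₁, a₃) ∨ ends e = s(a₂, a₃)) (ho : o ≠ a₃)
    (h1 : a₁ ≠ a₃) (b : V) : ZSplitIIQ p ends o a₁ a₂ a₃ b := by
  unfold ZSplitIIQ
  exact iiExprT_nonneg_of_dworld p hp ends o a₁ a₂ a₃ b _ _
    (iiExprD_nonneg_of_rootsAndO p hp he₀ hroot ho h1 b _ _ (prob_nonneg hp _) (prob_nonneg hp _))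
    (odds_q p hp ends o a₁ a₂ a₃)

end Induction

end CaseOne

end Summit.Ventures.PercRepro2
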